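import Summits.Parity.BatemanHorn.Theorems.SoloBlindLevel
import Mathlib.Analysis.SpecialFunctions.Pow.Asymptotics
import HarnessLib

/-!
# `n² + 1` has level of distribution exactly `x^{1/2}` in the tree's `HasLevelOfDistribution` — PROVED

Solo seat `solo-Parity-blind` (summit `Parity`, conjunct `BatemanHorn`), sequel to
`SoloBlindLevel.lean`.  There the calibration was phrased for the `N`-indexed family
`polyAPSeq (X² + 1) N 1 0`; here it is transported to the language in which the tree states the
hypotheses of the asymptotic sieves — ONE `SieveSequence` indexed by the real height `x`, and the
predicate `HasLevelOfDistribution A θ` (`= ∀ ε > 0, ∑_{d ≤ x^{θ−ε}, d squarefree} |R_d(x)| ≪_B X(x)/(log x)^B`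
for every `B`, `Literature.NumberTheory.Sieve.LevelOfDistribution`).

* `sqOneSeq` — the values `n² + 1`, `n ≥ 1`, as a sifted sequence on the values:
  `a_v = #{n ≥ 1 : n² + 1 = v}`, `X(x) = sqCount x = ⌊√(⌊x⌋ − 1)⌋ = #{n ≥ 1 : n² + 1 ≤ x}` (the exact
  number of members of height `≤ x`), `g(m) = ρ(m)/m` (`rootDensity (X² + 1)`);
* `sqOneSeq_remainder` — its remainders ARE those of `polyAPSeq (X² + 1) (sqCount x) 1 0` at the
  same `x`, so everything proved for the `N`-indexed family transfers;
* `sqOneSeq_hasLevelOfDistribution_half` — level `x^{1/2}` HOLDS (from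
  `sum_abs_remainder_le_linear`: `∑_{m ≤ D} |R_m| ≤ C·D`);
* `sqOneSeq_not_hasLevelOfDistribution` — level `x^θ` FAILS for every `θ > 1/2` (from
  `quadratic_level_le_half`: the primes `p ∈ (4X, x^{θ−ε}]` alone contribute `≫ X` to the
  remainder sum, while level `x^θ` with `B = 1` would make it `O(X/log x)`);
* `sqOneSeq_not_bombieri_level` — in particular the standing hypothesis
  `∀ θ < 1, HasLevelOfDistribution A θ` of Bombieri's asymptotic sieve, and a fortiori hypothesis
  (R) (`(R1)`: level `> x^{2/3}`) of the Friedlander–Iwaniec asymptotic sieve for primes, cannot be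
  instantiated with `A = sqOneSeq`.

This is the formal content of the seat's calibration (C1) for `n² + 1` in the tree's own hypothesis
language: the Type-I (linear-sieve-axiom) input available for a one-variable quadratic sequence is
exactly `γ = 1/2`, so no sieve whose hypotheses are Type-I bounds of level `> x^{1/2}` applies.
No `sorry`, no new axioms; the definitions `sqCount`, `sqOneSeq` are the only new objects.

References.  E. Bombieri, *The asymptotic sieve*, Rend. Accad. Naz. XL (5) 1/2 (1975/76), 243–269.
J. Friedlander, H. Iwaniec, *Asymptotic sieve for primes*, Ann. of Math. 148 (1998), 1041–1065,
hypotheses (R), (R1).  K. Ford, J. Maynard, arXiv:2407.14368 (2024), §1.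
-/

noncomputable section

open Finset Real Polynomial Filter Asymptotics
open Literature.NumberTheory.Sieve Literature.NumberTheory.Sieve.Iwaniec1978

namespace Summit.Parity.BatemanHorn.Theorems.SoloBlindLevel

/-! ### The sequence `n² + 1` indexed by the height -/

/-- `sqCount x = ⌊√(⌊x⌋ − 1)⌋ = #{n ≥ 1 : n² + 1 ≤ x}`, the number of members of height `≤ x`. -/
def sqCount (x : ℝ) : ℕ := Nat.sqrt (⌊x⌋₊ - 1)

/-- **The values `n² + 1`, `n ≥ 1`, as one sifted sequence indexed by the height `x`:**
`a_v = #{n ≥ 1 : n² + 1 = v}`, `X(x) = #{n ≥ 1 : n² + 1 ≤ x}`, `g(m) = ρ(m)/m`. -/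
def sqOneSeq : SieveSequence where
  a v := ((#((Ioc 0 v).filter fun n : ℕ => n ^ 2 + 1 = v) : ℕ) : ℝ)
  a_nonneg _ := Nat.cast_nonneg _
  size x := (sqCount x : ℝ)
  density := rootDensity (X ^ 2 + 1 : ℤ[X])
  density_mult := isMultiplicative_rootDensity _

/-- Unfolding lemma for the weights. -/
theorem sqOneSeq_a (v : ℕ) :
    sqOneSeq.a v = ((#((Ioc 0 v).filter fun n : ℕ => n ^ 2 + 1 = v) : ℕ) : ℝ) := rfl

/-- Unfolding lemma for the size. -/
theorem sqOneSeq_size (x : ℝ) : sqOneSeq.size x = (sqCount x : ℝ) := rfl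

/-- Unfolding lemma for the density. -/
theorem sqOneSeq_density : sqOneSeq.density = rootDensity (X ^ 2 + 1 : ℤ[X]) := rfl

/-- `(sqCount x)² ≤ ⌊x⌋ − 1`. -/
theorem sqCount_mul_self_le (x : ℝ) : sqCount x * sqCount x ≤ ⌊x⌋₊ - 1 := Nat.sqrt_le _

/-- The weights agree with those of `polyAPSeq (X² + 1) (sqCount x) 1 0` on `v ≤ ⌊x⌋`. -/
theorem sqOneSeq_a_eq {x : ℝ} {v : ℕ} (hv : v ≤ ⌊x⌋₊) :
    sqOneSeq.a v = (polyAPSeq (X ^ 2 + 1 : ℤ[X]) (sqCount x) 1 0).a v := by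
  rw [sqOneSeq_a, polyAPSeq_a]
  have hst : (Ioc 0 v).filter (fun n : ℕ => n ^ 2 + 1 = v) =
      (apIndex (sqCount x) 1 0).filter
        (fun n : ℕ => (X ^ 2 + 1 : ℤ[X]).eval (n : ℤ) = (v : ℤ)) := by
    ext n
    simp only [Finset.mem_filter, Finset.mem_Ioc, mem_apIndex, eval_add, eval_pow, eval_X,
      eval_one]
    constructor
    · rintro ⟨⟨hn0, -⟩, h⟩
      refine ⟨⟨⟨hn0, ?_⟩, Nat.modEq_one⟩, by exact_mod_cast h⟩
      rw [sqCount, Nat.le_sqrt]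
      rw [pow_two] at h
      omega
    · rintro ⟨⟨⟨hn0, -⟩, -⟩, h⟩
      have h' : n ^ 2 + 1 = v := by exact_mod_cast h
      rw [pow_two] at h'
      have hnn : n ≤ n * n := Nat.le_mul_self n
      refine ⟨⟨hn0, by omega⟩, by rw [pow_two]; exact h'⟩
  rw [hst]

/-- The congruence sums agree with those of `polyAPSeq (X² + 1) (sqCount x) 1 0`. -/
theorem sqOneSeq_congrSum (d : ℕ) (x : ℝ) :
    sqOneSeq.congrSum d x = (polyAPSeq (X ^ 2 + 1 : ℤ[X]) (sqCount x) 1 0).congrSum d x := by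
  unfold SieveSequence.congrSum
  refine Finset.sum_congr rfl fun v hv => ?_
  rw [Finset.mem_filter, Finset.mem_Ioc] at hv
  exact sqOneSeq_a_eq hv.1.2

/-- **The remainders agree**: `R_d(x)` of `sqOneSeq` is `R_d(x)` of
`polyAPSeq (X² + 1) (sqCount x) 1 0`. -/
theorem sqOneSeq_remainder (d : ℕ) (x : ℝ) :
    sqOneSeq.remainder d x = (polyAPSeq (X ^ 2 + 1 : ℤ[X]) (sqCount x) 1 0).remainder d x := by
  rw [SieveSequence.remainder, SieveSequence.remainder, sqOneSeq_congrSum, polyAPSeq_size,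
    polyAPSeq_density, sqOneSeq_size, sqOneSeq_density, Nat.cast_one, div_one]

/-- Every height `x ≥ 0` is admissible for `polyAPSeq (X² + 1) (sqCount x) 1 0`:
`0 < n² + 1 ≤ x` for `1 ≤ n ≤ sqCount x`. -/
theorem sqCount_admissible {x : ℝ} (hx : 0 ≤ x) :
    ∀ n ∈ apIndex (sqCount x) 1 0, 0 < (X ^ 2 + 1 : ℤ[X]).eval (n : ℤ) ∧
      (((X ^ 2 + 1 : ℤ[X]).eval (n : ℤ) : ℤ) : ℝ) ≤ x := by
  intro n hn
  rw [mem_apIndex] at hn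
  obtain ⟨⟨hn0, hnN⟩, -⟩ := hn
  simp only [eval_add, eval_pow, eval_X, eval_one]
  refine ⟨by positivity, ?_⟩
  have h1 : n * n ≤ ⌊x⌋₊ - 1 := (Nat.mul_self_le_mul_self hnN).trans (sqCount_mul_self_le x)
  have h2 : 0 < n * n := Nat.mul_pos hn0 hn0
  have h3 : n * n + 1 ≤ ⌊x⌋₊ := by omega
  have h4 : ((n * n + 1 : ℕ) : ℝ) ≤ x := le_trans (by exact_mod_cast h3) (Nat.floor_le hx)
  push_cast at h4 ⊢
  nlinarith [h4]

/-- `sqCount x ≥ 1` for `x ≥ 2`. -/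
theorem one_le_sqCount {x : ℝ} (hx : 2 ≤ x) : 1 ≤ sqCount x := by
  have h2 : 2 ≤ ⌊x⌋₊ := Nat.le_floor (by exact_mod_cast hx)
  rw [sqCount, Nat.le_sqrt]
  omega

/-- `sqCount x ≥ N₀` once `x ≥ N₀² + 1`. -/
theorem le_sqCount {x : ℝ} {N₀ : ℕ} (hx : ((N₀ * N₀ + 1 : ℕ) : ℝ) ≤ x) : N₀ ≤ sqCount x := by
  have h := Nat.le_floor hx
  rw [sqCount, Nat.le_sqrt]
  omega

/-- `x^{1/2} · x^{1/2} = x`. -/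
theorem rpow_half_mul_self {x : ℝ} (hx : 0 ≤ x) : x ^ (1 / 2 : ℝ) * x ^ (1 / 2 : ℝ) = x := by
  rw [← Real.rpow_add' hx (by norm_num), show (1 / 2 : ℝ) + 1 / 2 = 1 by norm_num, Real.rpow_one]

/-- `sqCount x ≤ x^{1/2}`. -/
theorem sqCount_le_rpow {x : ℝ} (hx : 0 ≤ x) : (sqCount x : ℝ) ≤ x ^ (1 / 2 : ℝ) := by
  have h1 : ((sqCount x * sqCount x : ℕ) : ℝ) ≤ x := by
    have : sqCount x * sqCount x ≤ ⌊x⌋₊ := (sqCount_mul_self_le x).trans (Nat.sub_le _ _)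
    exact le_trans (by exact_mod_cast this) (Nat.floor_le hx)
  push_cast at h1
  by_contra h
  have h' : x ^ (1 / 2 : ℝ) < sqCount x := not_le.mp h
  have h0 : 0 ≤ x ^ (1 / 2 : ℝ) := Real.rpow_nonneg hx _
  have := mul_self_lt_mul_self h0 h'
  rw [rpow_half_mul_self hx] at this
  linarith

/-- `x^{1/2} ≤ 3 · sqCount x` for `x ≥ 4`. -/
theorem rpow_half_le_three_mul_sqCount {x : ℝ} (hx : 4 ≤ x) :
    x ^ (1 / 2 : ℝ) ≤ 3 * sqCount x := by
  have hx0 : 0 ≤ x := by linarith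
  have hN1 : (1 : ℝ) ≤ sqCount x := by exact_mod_cast one_le_sqCount (by linarith : (2 : ℝ) ≤ x)
  have hF1 : 1 ≤ ⌊x⌋₊ := Nat.le_floor (by norm_num; linarith)
  have h1 : ⌊x⌋₊ - 1 < (sqCount x + 1) * (sqCount x + 1) := Nat.lt_succ_sqrt _
  have h2 : ((⌊x⌋₊ - 1 : ℕ) : ℝ) = (⌊x⌋₊ : ℝ) - 1 := by rw [Nat.cast_sub hF1, Nat.cast_one]
  have h3 : x < (⌊x⌋₊ : ℝ) + 1 := Nat.lt_floor_add_one x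
  have h4 : (⌊x⌋₊ : ℝ) - 1 < ((sqCount x : ℝ) + 1) * ((sqCount x : ℝ) + 1) := by
    rw [← h2]; exact_mod_cast h1
  have hP : (1 : ℝ) ≤ (sqCount x : ℝ) * sqCount x := by nlinarith
  have h6 : ((sqCount x : ℝ) + 1) * ((sqCount x : ℝ) + 1) ≤ 4 * ((sqCount x : ℝ) * sqCount x) := by
    nlinarith
  have h5 : x < 9 * ((sqCount x : ℝ) * sqCount x) := by linarith
  by_contra h
  have h' : 3 * (sqCount x : ℝ) < x ^ (1 / 2 : ℝ) := not_le.mp h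
  have := mul_self_lt_mul_self (by positivity) h'
  rw [rpow_half_mul_self hx0] at this
  nlinarith

/-! ### Level `x^{1/2}` holds -/

/-- **`n² + 1` has level of distribution `x^{1/2}`** (in the tree's sense: for every `ε > 0` and
`B > 0`, `∑_{d ≤ x^{1/2−ε}, d squarefree} |R_d(x)| ≪ X(x)/(log x)^B`). -/
theorem sqOneSeq_hasLevelOfDistribution_half : HasLevelOfDistribution sqOneSeq (1 / 2) := by
  simp only [HasLevelOfDistribution, SieveSequence.HasLevel]
  intro ε hε B hB
  have hdeg : 0 < (X ^ 2 + 1 : ℤ[X]).natDegree := by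
    rw [show (X ^ 2 + 1 : ℤ[X]) = X ^ 2 + C 1 by rw [C_1], natDegree_X_pow_add_C]; norm_num
  obtain ⟨C, hC0, hC⟩ :=
    sum_abs_remainder_le_linear (f := (X ^ 2 + 1 : ℤ[X])) irreducible_X_sq_add_one_int hdeg
  have h1 : ∀ᶠ x : ℝ in atTop, ‖Real.log x ^ B‖ ≤ 1 * ‖x ^ ε‖ :=
    (isLittleO_log_rpow_rpow_atTop B hε).bound one_pos
  have h2 : ∀ᶠ x : ℝ in atTop, ‖Real.log x ^ B‖ ≤ 1 / 2 * ‖x ^ (1 / 2 : ℝ)‖ :=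
    (isLittleO_log_rpow_rpow_atTop B (by norm_num : (0 : ℝ) < 1 / 2)).bound (by norm_num)
  refine Asymptotics.IsBigO.of_bound (6 * C) ?_
  filter_upwards [h1, h2, Filter.eventually_ge_atTop (4 : ℝ)] with x hx1 hx2 hx4
  have hx0 : 0 < x := by linarith
  have hlogpos : 0 < Real.log x := Real.log_pos (by linarith)
  have hL0 : 0 < Real.log x ^ B := Real.rpow_pos_of_pos hlogpos B
  rw [Real.norm_of_nonneg hL0.le, Real.norm_of_nonneg (Real.rpow_nonneg hx0.le _), one_mul] at hx1
  rw [Real.norm_of_nonneg hL0.le, Real.norm_of_nonneg (Real.rpow_nonneg hx0.le _)] at hx2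
  have hN := rpow_half_le_three_mul_sqCount hx4
  have hadm := sqCount_admissible hx0.le
  -- Type-I bound up to `D = max (x^{1/2−ε}) 2`
  have hD2 : (2 : ℝ) ≤ max (x ^ (1 / 2 - ε)) 2 := le_max_right _ _
  have hT := hC (sqCount x) (max (x ^ (1 / 2 - ε)) 2) hD2 x hadm
  have hS : ∑ d ∈ (Icc 1 ⌊x ^ (1 / 2 - ε)⌋₊).filter Squarefree, |sqOneSeq.remainder d x| ≤
      ∑ m ∈ Icc 1 ⌊max (x ^ (1 / 2 - ε)) 2⌋₊,
        |(polyAPSeq (X ^ 2 + 1 : ℤ[X]) (sqCount x) 1 0).remainder m x| := by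
    simp_rw [← sqOneSeq_remainder]
    refine Finset.sum_le_sum_of_subset_of_nonneg ?_ fun _ _ _ => abs_nonneg _
    exact (Finset.filter_subset _ _).trans
      (Finset.Icc_subset_Icc_right (Nat.floor_le_floor (le_max_left _ _)))
  have hS0 : 0 ≤ ∑ d ∈ (Icc 1 ⌊x ^ (1 / 2 - ε)⌋₊).filter Squarefree, |sqOneSeq.remainder d x| :=
    Finset.sum_nonneg fun _ _ => abs_nonneg _
  have hR0 : 0 ≤ (sqCount x : ℝ) / Real.log x ^ B := div_nonneg (Nat.cast_nonneg _) hL0.le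
  rw [Real.norm_of_nonneg hS0, sqOneSeq_size, Real.norm_of_nonneg hR0, ← mul_div_assoc,
    le_div_iff₀ hL0]
  have hmax : max (x ^ (1 / 2 - ε)) 2 ≤ x ^ (1 / 2 - ε) + 2 :=
    max_le (le_add_of_nonneg_right (by norm_num)) (le_add_of_nonneg_left (Real.rpow_nonneg hx0.le _))
  have hSx : ∑ d ∈ (Icc 1 ⌊x ^ (1 / 2 - ε)⌋₊).filter Squarefree, |sqOneSeq.remainder d x| ≤
      C * (x ^ (1 / 2 - ε) + 2) := hS.trans (hT.trans (mul_le_mul_of_nonneg_left hmax hC0.le))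
  have hhalf : x ^ (1 / 2 - ε) * x ^ ε = x ^ (1 / 2 : ℝ) := by
    rw [← Real.rpow_add hx0]; congr 1; ring
  have hkey : (x ^ (1 / 2 - ε) + 2) * Real.log x ^ B ≤ 2 * x ^ (1 / 2 : ℝ) := by
    have ha : x ^ (1 / 2 - ε) * Real.log x ^ B ≤ x ^ (1 / 2 - ε) * x ^ ε :=
      mul_le_mul_of_nonneg_left hx1 (Real.rpow_nonneg hx0.le _)
    rw [hhalf] at ha
    nlinarith [ha, hx2]
  calc (∑ d ∈ (Icc 1 ⌊x ^ (1 / 2 - ε)⌋₊).filter Squarefree, |sqOneSeq.remainder d x|) *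
        Real.log x ^ B
      ≤ C * (x ^ (1 / 2 - ε) + 2) * Real.log x ^ B := mul_le_mul_of_nonneg_right hSx hL0.le
    _ = C * ((x ^ (1 / 2 - ε) + 2) * Real.log x ^ B) := by ring
    _ ≤ C * (2 * x ^ (1 / 2 : ℝ)) := mul_le_mul_of_nonneg_left hkey hC0.le
    _ ≤ C * (2 * (3 * sqCount x)) := by nlinarith [hN, hC0]
    _ = 6 * C * (sqCount x : ℝ) := by ring

/-! ### No level beyond `x^{1/2}` -/

/-- **`n² + 1` does NOT have level of distribution `x^θ` for any `θ > 1/2`.** -/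
theorem sqOneSeq_not_hasLevelOfDistribution {θ : ℝ} (hθ : 1 / 2 < θ) :
    ¬ HasLevelOfDistribution sqOneSeq θ := by
  intro hL
  simp only [HasLevelOfDistribution, SieveSequence.HasLevel] at hL
  -- parameters: `δ = θ − 1/2`, sieve-epsilon `δ/2`, `B = 1`
  obtain ⟨δ, hδ⟩ : ∃ δ : ℝ, δ = θ - 1 / 2 := ⟨_, rfl⟩
  have hδ0 : 0 < δ := by rw [hδ]; linarith
  have hBig : (fun x : ℝ => ∑ d ∈ (Icc 1 ⌊x ^ (θ - δ / 2)⌋₊).filter Squarefree,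
      |sqOneSeq.remainder d x|) =O[atTop] fun x : ℝ => sqOneSeq.size x / Real.log x ^ (1 : ℝ) :=
    hL (δ / 2) (by positivity) 1 one_pos
  obtain ⟨c, hc⟩ := hBig.bound
  obtain ⟨x₁, hx₁⟩ := Filter.eventually_atTop.mp hc
  -- the landed lower bound with `ε = δ/2`
  have hirr : Irreducible (quadPoly 1 0 1) := by
    rw [quadPoly_one_zero_one]; exact irreducible_X_sq_add_one_int
  obtain ⟨N₀, hN₀⟩ := quadratic_level_le_half (a := 1) (b := 0) (c := 1) one_pos odd_one hirr
    (ε := δ / 2) (by positivity)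
  rw [quadPoly_one_zero_one] at hN₀
  obtain ⟨c₀, hc₀⟩ : ∃ c₀ : ℝ, c₀ = δ / 2 / (2 * (1 + δ / 2)) := ⟨_, rfl⟩
  have hc₀0 : 0 < c₀ := by rw [hc₀]; positivity
  -- a large height `x`
  obtain ⟨x, hxx₁, hxX₂, hxX₃, hxX₄, hx4⟩ : ∃ x : ℝ, x₁ ≤ x ∧ ((N₀ * N₀ + 1 : ℕ) : ℝ) ≤ x ∧
      Real.exp (|c| / c₀ + 1) ≤ x ∧ (2 : ℝ) ^ (4 / δ) ≤ x ∧ 4 ≤ x :=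
    ⟨max (max x₁ ((N₀ * N₀ + 1 : ℕ) : ℝ)) (max (Real.exp (|c| / c₀ + 1)) (max ((2 : ℝ) ^ (4 / δ)) 4)),
      (le_max_left _ _).trans (le_max_left _ _),
      (le_max_right _ _).trans (le_max_left _ _),
      (le_max_left _ _).trans (le_max_right _ _),
      (le_max_left _ _).trans ((le_max_right _ _).trans (le_max_right _ _)),
      (le_max_right _ _).trans ((le_max_right _ _).trans (le_max_right _ _))⟩
  have hx0 : 0 < x := by linarith
  have hx1 : 1 ≤ x := by linarith
  have hN₀N : N₀ ≤ sqCount x := le_sqCount hxX₂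
  have hN1 : (1 : ℝ) ≤ sqCount x := by exact_mod_cast one_le_sqCount (by linarith : (2 : ℝ) ≤ x)
  have hN0 : (0 : ℝ) < sqCount x := by linarith
  have hNle : (sqCount x : ℝ) ≤ x ^ (1 / 2 : ℝ) := sqCount_le_rpow hx0.le
  have hlogx : |c| / c₀ + 1 ≤ Real.log x := by
    rw [← Real.log_exp (|c| / c₀ + 1)]
    exact Real.log_le_log (Real.exp_pos _) hxX₃
  have hlogpos : 0 < Real.log x := Real.log_pos (by linarith)
  have hxδ : (2 : ℝ) ≤ x ^ (δ / 4) := by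
    have hne : δ ≠ 0 := hδ0.ne'
    calc (2 : ℝ) = ((2 : ℝ) ^ (4 / δ)) ^ (δ / 4) := by
          rw [← Real.rpow_mul (by norm_num : (0 : ℝ) ≤ 2), show 4 / δ * (δ / 4) = 1 by field_simp,
            Real.rpow_one]
      _ ≤ x ^ (δ / 4) := Real.rpow_le_rpow (by positivity) hxX₄ (by positivity)
  -- `N^{1+δ/2} ≤ V = ⌊x^{θ−δ/2}⌋`
  have hθ' : θ - δ / 2 = (1 / 2 + δ / 4) + δ / 4 := by rw [hδ]; ring
  have hNV : (sqCount x : ℝ) ^ (1 + δ / 2) ≤ (⌊x ^ (θ - δ / 2)⌋₊ : ℝ) := by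
    have h1 : (sqCount x : ℝ) ^ (1 + δ / 2) ≤ x ^ (1 / 2 + δ / 4) :=
      calc (sqCount x : ℝ) ^ (1 + δ / 2) ≤ (x ^ (1 / 2 : ℝ)) ^ (1 + δ / 2) :=
            Real.rpow_le_rpow (by positivity) hNle (by positivity)
        _ = x ^ (1 / 2 + δ / 4) := by rw [← Real.rpow_mul hx0.le]; congr 1; ring
    have h2 : x ^ (1 / 2 + δ / 4) + 1 ≤ x ^ (θ - δ / 2) := by
      rw [hθ', Real.rpow_add hx0 (1 / 2 + δ / 4) (δ / 4)]
      have h3 : (1 : ℝ) ≤ x ^ (1 / 2 + δ / 4) := Real.one_le_rpow hx1 (by positivity)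
      nlinarith [hxδ, h3]
    have h4 : x ^ (θ - δ / 2) < (⌊x ^ (θ - δ / 2)⌋₊ : ℝ) + 1 := Nat.lt_floor_add_one _
    linarith
  -- the lower bound, transported to `sqOneSeq` and enlarged to the squarefree sum
  have hadm := sqCount_admissible hx0.le
  have hlow := hN₀ (sqCount x) hN₀N ⌊x ^ (θ - δ / 2)⌋₊ hNV x hadm
  have hsub : (Ioc (4 * sqCount x) ⌊x ^ (θ - δ / 2)⌋₊).filter Nat.Prime ⊆
      (Icc 1 ⌊x ^ (θ - δ / 2)⌋₊).filter Squarefree := by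
    intro p hp
    rw [Finset.mem_filter, Finset.mem_Ioc] at hp
    rw [Finset.mem_filter, Finset.mem_Icc]
    exact ⟨⟨hp.2.one_lt.le, hp.1.2⟩, hp.2.prime.squarefree⟩
  have hle : ∑ p ∈ (Ioc (4 * sqCount x) ⌊x ^ (θ - δ / 2)⌋₊).filter Nat.Prime,
        |(polyAPSeq (X ^ 2 + 1 : ℤ[X]) (sqCount x) 1 0).remainder p x| ≤
      ∑ d ∈ (Icc 1 ⌊x ^ (θ - δ / 2)⌋₊).filter Squarefree, |sqOneSeq.remainder d x| := by
    simp_rw [← sqOneSeq_remainder]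
    exact Finset.sum_le_sum_of_subset_of_nonneg hsub fun _ _ _ => abs_nonneg _
  -- the upper bound at `x`
  have hup := hx₁ x hxx₁
  have hS0 : 0 ≤ ∑ d ∈ (Icc 1 ⌊x ^ (θ - δ / 2)⌋₊).filter Squarefree, |sqOneSeq.remainder d x| :=
    Finset.sum_nonneg fun _ _ => abs_nonneg _
  have hR0 : 0 ≤ (sqCount x : ℝ) / Real.log x := div_nonneg (Nat.cast_nonneg _) hlogpos.le
  rw [Real.norm_of_nonneg hS0, sqOneSeq_size, Real.rpow_one, Real.norm_of_nonneg hR0] at hup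
  -- combine: `c₀ X ≤ |c| X / log x`, so `c₀ log x ≤ |c|`, contradicting `log x ≥ |c|/c₀ + 1`
  have h1 : c₀ * (sqCount x : ℝ) ≤ |c| * (sqCount x : ℝ) / Real.log x := by
    have : c * ((sqCount x : ℝ) / Real.log x) ≤ |c| * ((sqCount x : ℝ) / Real.log x) :=
      mul_le_mul_of_nonneg_right (le_abs_self c) hR0
    rw [mul_div_assoc, hc₀]
    linarith
  rw [le_div_iff₀ hlogpos] at h1
  have h3 : c₀ * Real.log x * (sqCount x : ℝ) ≤ |c| * (sqCount x : ℝ) := by linarith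
  have h2 : c₀ * Real.log x ≤ |c| := le_of_mul_le_mul_right h3 hN0
  have h4 : c₀ * (|c| / c₀ + 1) = |c| + c₀ := by field_simp
  have h5 : c₀ * (|c| / c₀ + 1) ≤ c₀ * Real.log x := mul_le_mul_of_nonneg_left hlogx hc₀0.le
  linarith

/-- **Corollary: the standing hypothesis of Bombieri's asymptotic sieve fails for `n² + 1`.**
`∀ θ < 1, HasLevelOfDistribution A θ` cannot be instantiated with `A = sqOneSeq`; a fortiori
neither can hypothesis (R) of the Friedlander–Iwaniec asymptotic sieve for primes (level `> x^{2/3}`). -/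
theorem sqOneSeq_not_bombieri_level : ¬ ∀ θ : ℝ, θ < 1 → HasLevelOfDistribution sqOneSeq θ :=
  fun h => sqOneSeq_not_hasLevelOfDistribution (θ := 3 / 4) (by norm_num) (h _ (by norm_num))

end Summit.Parity.BatemanHorn.Theorems.SoloBlindLevel

end
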